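import Summits.Ventures.Crystal3D.Theorems.StickyWulffConstantCoaxialWallLawWordMoves
import Summits.Ventures.Crystal3D.Theorems.StickyWulffConstantCoaxialWallLawEndRowDefs
import HarnessLib

/-!
# Bookkeeping lemmas for the CUT launch census: the class never newly ends in the cut letter; a straight mover is off the cut
# (lane T, crux `TextureLiminfV5`, stmt-Ventures-23912, registered stub `stub_terraceCensus`; (β) terrace census, LevelReach — relaunch term)

HONEST FRAMING. Venture `Summits/Ventures/Crystal3D` (cell `crystal3d-full`), route `route-Ventures-StickyWulffConstant`, helper `--supports`
the law-v5 crux `TextureLiminfV5` (stmt-Ventures-23912), lane T, mechanism (β).  Three small lemmas consumed by `word_family_endPairs_launch_cut`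
(…TexShadowLevelReachCut): pure list bookkeeping of lane F's class-change map `next` (push `(F κ)⁻¹ m :: κ`, pop to the tail) and one exclusion in
the mover vocabulary of …CoaxialWallLawEndRowDefs.  Census-free; nothing about energies; F-C1 not moved.
* `word_next_shape` — `next κ m` is the push `(F κ)⁻¹ m :: κ` or the pop to the tail of `κ`;
* `word_next_eq_nil` — `next κ m = []` forces `κ = [μ]`;
* `word_next_getLast_ne` — if `κ` does not END (list-last = first-pushed letter) in `μ₀`, neither does `next κ m`, unless the move is the push of
  `μ₀` itself from the root (`κ = []`, `m = F [] μ₀`);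
* `not_isTwinReading_of_straightMover` — a state moving STRAIGHT along `G w` (full, glide, or narrow) is not a twin reading of a normal `n₀` crossed
  upward by `G w` (the target slot is a far slot of `n₀`; for the glide, one frame reads one normal, `twinDozen_normal_eq_self`).
WHAT THIS IS NOT: any count; F-C1 not moved.
-/

noncomputable section

namespace Summit.Ventures.Crystal3D.Theorems

open Summit.Ventures.Crystal3D Finset
open scoped InnerProductSpace

section Next

variable {F : List (EuclideanSpace ℝ (Fin 3)) → (EuclideanSpace ℝ (Fin 3) ≃ₗᵢ[ℝ] EuclideanSpace ℝ (Fin 3))}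
  {next : List (EuclideanSpace ℝ (Fin 3)) → EuclideanSpace ℝ (Fin 3) → List (EuclideanSpace ℝ (Fin 3))}

/-- **`next κ m` is a push or a pop.** -/
theorem word_next_shape
    (hnext_pop : ∀ μ κ' (m : EuclideanSpace ℝ (Fin 3)), (F (μ :: κ')).symm m = -μ → next (μ :: κ') m = κ')
    (hnext_push : ∀ κ (m : EuclideanSpace ℝ (Fin 3)), (∀ μ κ', κ = μ :: κ' → (F κ).symm m ≠ -μ) →
      next κ m = (F κ).symm m :: κ)
    (κ : List (EuclideanSpace ℝ (Fin 3))) (m : EuclideanSpace ℝ (Fin 3)) :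
    next κ m = (F κ).symm m :: κ ∨ ∃ μ κ', κ = μ :: κ' ∧ next κ m = κ' := by
  by_cases hpush : ∀ μ κ', κ = μ :: κ' → (F κ).symm m ≠ -μ
  · exact Or.inl (hnext_push κ m hpush)
  · push Not at hpush
    obtain ⟨μ, κ', hκe, hsymm⟩ := hpush
    refine Or.inr ⟨μ, κ', hκe, ?_⟩
    have hpop := hnext_pop μ κ' m (by rw [← hκe]; exact hsymm)
    rw [← hκe] at hpop; exact hpop

/-- **`next κ m = []` forces a pop from a one-letter class.** -/
theorem word_next_eq_nil
    (hnext_pop : ∀ μ κ' (m : EuclideanSpace ℝ (Fin 3)), (F (μ :: κ')).symm m = -μ → next (μ :: κ') m = κ')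
    (hnext_push : ∀ κ (m : EuclideanSpace ℝ (Fin 3)), (∀ μ κ', κ = μ :: κ' → (F κ).symm m ≠ -μ) →
      next κ m = (F κ).symm m :: κ)
    {κ : List (EuclideanSpace ℝ (Fin 3))} {m : EuclideanSpace ℝ (Fin 3)} (hnil : next κ m = []) : ∃ μ, κ = [μ] := by
  rcases word_next_shape hnext_pop hnext_push κ m with hpush | ⟨μ, κ', hκe, hpop⟩
  · rw [hnil] at hpush; exact absurd hpush.symm (List.cons_ne_nil _ _)
  · rw [hnil] at hpop; exact ⟨μ, by rw [hκe, ← hpop]⟩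

/-- **The class never newly ENDS in the cut letter.**  If `κ` does not end in `μ₀` (`κ.getLast? ≠ some μ₀`) and the move is not the root push of
`μ₀` (`κ ≠ [] ∨ m ≠ F [] μ₀`), then `next κ m` does not end in `μ₀`. -/
theorem word_next_getLast_ne
    (hnext_pop : ∀ μ κ' (m : EuclideanSpace ℝ (Fin 3)), (F (μ :: κ')).symm m = -μ → next (μ :: κ') m = κ')
    (hnext_push : ∀ κ (m : EuclideanSpace ℝ (Fin 3)), (∀ μ κ', κ = μ :: κ' → (F κ).symm m ≠ -μ) →
      next κ m = (F κ).symm m :: κ)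
    {μ₀ : EuclideanSpace ℝ (Fin 3)} (κ : List (EuclideanSpace ℝ (Fin 3))) (m : EuclideanSpace ℝ (Fin 3))
    (hlast : κ.getLast? ≠ some μ₀) (hoff : κ ≠ [] ∨ m ≠ F [] μ₀) : (next κ m).getLast? ≠ some μ₀ := by
  rcases word_next_shape hnext_pop hnext_push κ m with hpush | ⟨μ, κ', hκe, hpop⟩
  · rw [hpush]
    rcases κ with _ | ⟨b, l'⟩
    · -- push from the root: the new letter is `(F [])⁻¹ m ≠ μ₀`
      have hm : m ≠ F [] μ₀ := by
        rcases hoff with h | h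
        · exact absurd rfl h
        · exact h
      rw [List.getLast?_singleton]
      intro heq
      apply hm
      rw [← Option.some.inj heq, LinearIsometryEquiv.apply_symm_apply]
    · rw [List.getLast?_cons_cons]; exact hlast
  · rw [hpop]
    subst hκe
    rcases κ' with _ | ⟨b, l'⟩
    · simp
    · rw [List.getLast?_cons_cons] at hlast; exact hlast

end Next

/-- **A straight mover is off the cut.**  If the state `p` moves straight along `G w` (full in `G`, or a glide reading `(G, m)` with `⟪G w, m⟫ = 0`,
or — version `v2` — narrow along `G w`) and `n₀` is a normal crossed upward by `G w` (`⟪G w, n₀⟫ = √(2/3)`), then `p` is NOT a twin reading of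
`(G, n₀)`: the target site `p + G w` is a far slot of `n₀` (empty at a reading, occupied for full / narrow), and a glide reading has normal `n₀` itself. -/
theorem not_isTwinReading_of_straightMover {X : Finset (EuclideanSpace ℝ (Fin 3))} (ver : WordVersion)
    (G : EuclideanSpace ℝ (Fin 3) ≃ₗᵢ[ℝ] EuclideanSpace ℝ (Fin 3)) {w n₀ p : EuclideanSpace ℝ (Fin 3)} (hw : w ∈ fccSlots)
    (hwn : ⟪G w, n₀⟫_ℝ = Real.sqrt (2 / 3))
    (hmv : IsFull X G p ∨ (∃ m, IsTwinReading X G m p ∧ ⟪G w, m⟫_ℝ = 0) ∨ (ver = WordVersion.v2 ∧ IsNarrow X G (G w) p)) :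
    ¬ IsTwinReading X G n₀ p := by
  intro hcut
  have hr : 0 < Real.sqrt (2 / 3) := Real.sqrt_pos.2 (by norm_num)
  have hfar : p + G w ∉ X := hcut.2.2.2 w hw (by rw [hwn]; exact hr)
  rcases hmv with hfull | ⟨m, htd, h0⟩ | ⟨-, hnar⟩
  · exact hfar (hfull w hw)
  · have hmn : m = n₀ := twinDozen_normal_eq_self G htd.1.1 hcut.1.1 htd.1.2 hcut.1.2 htd.2.1 hcut.2.2.2
    rw [hmn, hwn] at h0
    exact absurd h0 (ne_of_gt hr)
  · exact hfar hnar.1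

end Summit.Ventures.Crystal3D.Theorems

end
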